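import Mathlib
import Literature.Analysis.FluidPDE.EnstrophySplitting
import Summits.NavierStokesRegularity.NavierStokesRegularity.Theorems.QuarterLogPincerSmoothSilenceDefs
import HarnessLib

/-!
# No fast silencing: the span of a smooth failing family is bounded below — refuter lane ns-afl-r1

Supports crux stmt-NavierStokesRegularity-24077 (`QuarterLogPincer.TypeIQuantSubcubicExp`) via ns-idea-7's line
`smooth_silence` (Sc″ `SmoothSilence.DriftStretchSilencingCost`, L♯1 `SmoothNormalisation`, L♯2 `SmoothLimitStep`),
objects in the tree BY NAME (`…Theorems.QuarterLogPincerSmoothSilenceDefs`).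

A constraint on counterexamples (negative-side information for Sc″ and a hidden obligation of L♯2): in the unit-scale
drift–stretch class (`DriftStretchBox B γ 1 …`: `‖∇ʲω‖ ≤ B` for `j ≤ 5`, `‖∇ʲv‖ ≤ B` for `j ≤ 4`, and the
vorticity equation `∂ₛω = Δω + (∇v)ω − (∇ω)v`) the enstrophy DENSITY obeys, along every time line,
`∂ₛ‖ω‖² = 2⟪ω, ∂ₛω⟫ ≥ −(6B² + 4B³)` pointwise (`‖Δω‖ ≤ 3‖∇²ω‖ ≤ 3B`, `‖(∇v)ω‖, ‖(∇ω)v‖ ≤ B²`) —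
`two_inner_timeDeriv_ge_of_driftStretchBox`.  Hence `‖ω(s₁,x)‖² ≥ ‖ω(0,x)‖² − (6B²+4B³)s₁` on `B(0,Γ₂)`
(mean value theorem) and, integrating, a member of `SmoothFailingFamily` with centre enstrophy `≥ δ` at
`s = 0` and final enstrophy `< 1/(n+1)` on `B(0,Γ₂+n) ⊇ B(0,Γ₂)` must have span
`s₁ > (δ − 1/(n+1)) / ((6B²+4B³)·(4π/3)Γ₂³)` — `smoothFailingFamily_member_span_floor`; packaged at
family level as `smoothFailingFamily_span_floor`.  Consequences: (i) a refuter's failing family cannot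
silence instantaneously (every cheap witness with `s₁ ↓ 0` is excluded); (ii) the compactness step L♯2
may assume `inf_n s₁(n) > 0` for `n` large, which the statement of `SmoothFailingFamily` does not
display.  (The analogue for the `C¹` inequality class of Sc′ `LimitSilence.ThickBoxSilencingCost` needs one
integration by parts — no `Δω` bound is available there — and is not done here.)

HONEST FRAME: calculus on the line's own objects; no statement of the route is proved or refuted; 24077,
W7 and Navier–Stokes regularity remain OPEN.  Theorem-only file.
-/

set_option linter.dupNamespace false

namespace Summit.NavierStokesRegularity.NavierStokesRegularity.Theorems.TypeIQuantSubcubicExp.Negative.SmoothSilence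

noncomputable section

open MeasureTheory Set Metric
open scoped Laplacian ENNReal
open Literature.Analysis Literature.Analysis.FluidPDE
open Summit.NavierStokesRegularity.NavierStokesRegularity.Cruxes.TypeIQuantSubcubicExp.SmoothSilence

/-- **Pointwise rate bound.**  In the unit-scale drift–stretch class, along each time line through a point of
the box the enstrophy density `s ↦ ‖ω s x‖²` is differentiable within the time set with derivative
`2⟪ω, ∂ₛω⟫ ≥ −(6B² + 4B³)`. -/
theorem two_inner_timeDeriv_ge_of_driftStretchBox {B γ : ℝ}
    {ω v : ℝ → (EuclideanSpace ℝ (Fin 3)) → (EuclideanSpace ℝ (Fin 3))} {y : EuclideanSpace ℝ (Fin 3)}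
    {S : Set ℝ} {ρ : ℝ} (h : DriftStretchBox B γ 1 ω v y S ρ) {s : ℝ} (hs : s ∈ S)
    {x : EuclideanSpace ℝ (Fin 3)} (hx : x ∈ ball y ρ) :
    HasDerivWithinAt (fun s => ‖ω s x‖ ^ 2) (2 * inner ℝ (ω s x) (timeDerivWithin S ω s x)) S s ∧
      -(6 * B ^ 2 + 4 * B ^ 3) ≤ 2 * inner ℝ (ω s x) (timeDerivWithin S ω s x) := by
  obtain ⟨hsmω, hsmv, hbox⟩ := h
  obtain ⟨hω, hv, -, heq⟩ := hbox s hs x hx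
  have hder : HasDerivWithinAt (fun s => ω s x) (timeDerivWithin S ω s x) S s :=
    (hsmω.differentiableWithinAt_time hs x).hasDerivWithinAt
  refine ⟨hder.norm_sq, ?_⟩
  -- the bounds at unit scale: `1 ^ r = 1`
  have h1 : ∀ r : ℝ, B * (1 : ℝ) ^ r = B := fun r => by rw [Real.one_rpow, mul_one]
  have hω0 : ‖ω s x‖ ≤ B := by
    have := hω 0 (by norm_num); rw [h1, norm_iteratedFDeriv_zero] at this; exact this
  have hB : 0 ≤ B := (norm_nonneg _).trans hω0
  have hω1 : ‖fderiv ℝ (ω s) x‖ ≤ B := by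
    have := hω 1 (by norm_num); rw [h1, norm_iteratedFDeriv_one] at this; exact this
  have hω2 : ‖iteratedFDeriv ℝ 2 (ω s) x‖ ≤ B := by
    have := hω 2 (by norm_num); rw [h1] at this; exact this
  have hv0 : ‖v s x‖ ≤ B := by
    have := hv 0 (by norm_num); rw [h1, norm_iteratedFDeriv_zero] at this; exact this
  have hv1 : ‖fderiv ℝ (v s) x‖ ≤ B := by
    have := hv 1 (by norm_num); rw [h1, norm_iteratedFDeriv_one] at this; exact this
  have hΔ : ‖(Δ (ω s)) x‖ ≤ 3 * B := by
    have h2 : ContDiff ℝ 2 (ω s) := (hsmω.contDiff_slice hs).of_le (by norm_cast)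
    exact (norm_laplacian_le_three_mul_norm_iteratedFDeriv_two h2 x).trans (by linarith)
  have hrate : ‖timeDerivWithin S ω s x‖ ≤ 3 * B + 2 * B ^ 2 := by
    have e1 : ‖fderiv ℝ (v s) x (ω s x)‖ ≤ B * B :=
      (ContinuousLinearMap.le_opNorm _ _).trans (mul_le_mul hv1 hω0 (norm_nonneg _) hB)
    have e2 : ‖fderiv ℝ (ω s) x (v s x)‖ ≤ B * B :=
      (ContinuousLinearMap.le_opNorm _ _).trans (mul_le_mul hω1 hv0 (norm_nonneg _) hB)
    have e3 := norm_add_le ((Δ (ω s)) x) (fderiv ℝ (v s) x (ω s x))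
    have e4 := norm_sub_le ((Δ (ω s)) x + fderiv ℝ (v s) x (ω s x)) (fderiv ℝ (ω s) x (v s x))
    rw [heq]
    linarith
  have habs : |inner ℝ (ω s x) (timeDerivWithin S ω s x)| ≤ B * (3 * B + 2 * B ^ 2) :=
    (abs_real_inner_le_norm _ _).trans (mul_le_mul hω0 hrate (norm_nonneg _) hB)
  have := (abs_le.mp habs).1
  nlinarith [this]

/-- **No fast silencing (member level).**  A member of a smooth failing family — unit-scale drift–stretch box on
`[0,s₁] × B(0, 2(Γ₂+n))`, centre enstrophy `≥ δ` on `B(0,Γ₂)` at `s = 0`, final enstrophy `< 1/(n+1)` on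
`B(0, Γ₂+n)` — has `δ < 1/(n+1) + (6B² + 4B³)·s₁·(4π/3)Γ₂³`, i.e. its span is bounded below by
`(δ − 1/(n+1)) / ((6B²+4B³)(4π/3)Γ₂³)`. -/
theorem smoothFailingFamily_member_span_floor {B γ δ Γ₂ s₁ : ℝ} {n : ℕ}
    {ω v : ℝ → (EuclideanSpace ℝ (Fin 3)) → (EuclideanSpace ℝ (Fin 3))} (hB : 0 ≤ B) (hΓ : 0 ≤ Γ₂)
    (hs₁ : 0 < s₁)
    (hbox : DriftStretchBox B γ 1 ω v 0 (Icc 0 s₁) (2 * (Γ₂ + n)))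
    (hδ : ENNReal.ofReal δ ≤ ∫⁻ x in ball (0 : (EuclideanSpace ℝ (Fin 3))) Γ₂, ‖ω 0 x‖ₑ ^ 2)
    (hfin : ∫⁻ x in ball (0 : (EuclideanSpace ℝ (Fin 3))) (Γ₂ + n), ‖ω s₁ x‖ₑ ^ 2 <
      ENNReal.ofReal (1 / ((n : ℝ) + 1))) :
    δ < 1 / ((n : ℝ) + 1) + (6 * B ^ 2 + 4 * B ^ 3) * s₁ * (Γ₂ ^ 3 * (Real.pi * 4 / 3)) := by
  set L : ℝ := 6 * B ^ 2 + 4 * B ^ 3 with hL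
  have hL0 : 0 ≤ L := by positivity
  -- (1) pointwise on the centre ball: `‖ω 0 x‖² ≤ ‖ω s₁ x‖² + L s₁`
  have hpt : ∀ x ∈ ball (0 : (EuclideanSpace ℝ (Fin 3))) Γ₂,
      ‖ω 0 x‖ ^ 2 ≤ ‖ω s₁ x‖ ^ 2 + L * s₁ := by
    intro x hx
    have hx' : x ∈ ball (0 : (EuclideanSpace ℝ (Fin 3))) (2 * (Γ₂ + n)) :=
      ball_subset_ball (by have : (0 : ℝ) ≤ n := n.cast_nonneg; linarith) hx
    have hder : ∀ s ∈ Icc 0 s₁,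
        HasDerivWithinAt (fun s => ‖ω s x‖ ^ 2) (2 * inner ℝ (ω s x) (timeDerivWithin (Icc 0 s₁) ω s x))
          (Icc 0 s₁) s ∧
        -L ≤ 2 * inner ℝ (ω s x) (timeDerivWithin (Icc 0 s₁) ω s x) :=
      fun s hs => two_inner_timeDeriv_ge_of_driftStretchBox hbox hs hx'
    have hcont : ContinuousOn (fun s => ‖ω s x‖ ^ 2) (Icc 0 s₁) :=
      fun s hs => (hder s hs).1.continuousWithinAt
    have hat : ∀ s ∈ Ioo 0 s₁,
        HasDerivAt (fun s => ‖ω s x‖ ^ 2) (2 * inner ℝ (ω s x) (timeDerivWithin (Icc 0 s₁) ω s x)) s :=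
      fun s hs => (hder s (Ioo_subset_Icc_self hs)).1.hasDerivAt (Icc_mem_nhds hs.1 hs.2)
    have hdiff : DifferentiableOn ℝ (fun s => ‖ω s x‖ ^ 2) (interior (Icc 0 s₁)) := by
      rw [interior_Icc]
      exact fun s hs => (hat s hs).differentiableAt.differentiableWithinAt
    have hge : ∀ s ∈ interior (Icc 0 s₁), -L ≤ deriv (fun s => ‖ω s x‖ ^ 2) s := by
      rw [interior_Icc]
      intro s hs
      rw [(hat s hs).deriv]
      exact (hder s (Ioo_subset_Icc_self hs)).2
    have hmv := (convex_Icc 0 s₁).mul_sub_le_image_sub_of_le_deriv hcont hdiff hge 0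
      (left_mem_Icc.2 hs₁.le) s₁ (right_mem_Icc.2 hs₁.le) hs₁.le
    simp only [sub_zero] at hmv
    linarith
  -- (2) the same in `ℝ≥0∞`
  have hpt' : ∀ x ∈ ball (0 : (EuclideanSpace ℝ (Fin 3))) Γ₂,
      ‖ω 0 x‖ₑ ^ 2 ≤ ‖ω s₁ x‖ₑ ^ 2 + ENNReal.ofReal (L * s₁) := by
    intro x hx
    rw [← ofReal_norm, ← ofReal_norm, ← ENNReal.ofReal_pow (norm_nonneg _),
      ← ENNReal.ofReal_pow (norm_nonneg _)]
    exact (ENNReal.ofReal_le_ofReal (hpt x hx)).trans ENNReal.ofReal_add_le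
  -- (3) integrate over the centre ball and compare with the final ball
  have hvol : ENNReal.ofReal (L * s₁) * volume (ball (0 : (EuclideanSpace ℝ (Fin 3))) Γ₂) =
      ENNReal.ofReal (L * s₁ * (Γ₂ ^ 3 * (Real.pi * 4 / 3))) := by
    rw [EuclideanSpace.volume_ball_fin_three, ← ENNReal.ofReal_pow hΓ,
      ← ENNReal.ofReal_mul (by positivity), ← ENNReal.ofReal_mul (by positivity)]
  have hsub : ball (0 : (EuclideanSpace ℝ (Fin 3))) Γ₂ ⊆ ball 0 (Γ₂ + n) :=
    ball_subset_ball (by have : (0 : ℝ) ≤ n := n.cast_nonneg; linarith)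
  have hchain : ENNReal.ofReal δ <
      ENNReal.ofReal (1 / ((n : ℝ) + 1)) + ENNReal.ofReal (L * s₁ * (Γ₂ ^ 3 * (Real.pi * 4 / 3))) :=
    calc ENNReal.ofReal δ ≤ ∫⁻ x in ball (0 : (EuclideanSpace ℝ (Fin 3))) Γ₂, ‖ω 0 x‖ₑ ^ 2 := hδ
      _ ≤ ∫⁻ x in ball (0 : (EuclideanSpace ℝ (Fin 3))) Γ₂, (‖ω s₁ x‖ₑ ^ 2 + ENNReal.ofReal (L * s₁)) :=
          setLIntegral_mono' measurableSet_ball hpt'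
      _ = (∫⁻ x in ball (0 : (EuclideanSpace ℝ (Fin 3))) Γ₂, ‖ω s₁ x‖ₑ ^ 2) +
            ENNReal.ofReal (L * s₁) * volume (ball (0 : (EuclideanSpace ℝ (Fin 3))) Γ₂) := by
          rw [lintegral_add_right _ measurable_const, setLIntegral_const]
      _ ≤ (∫⁻ x in ball (0 : (EuclideanSpace ℝ (Fin 3))) (Γ₂ + n), ‖ω s₁ x‖ₑ ^ 2) +
            ENNReal.ofReal (L * s₁ * (Γ₂ ^ 3 * (Real.pi * 4 / 3))) := by
          rw [hvol]; exact add_le_add_left (lintegral_mono_set hsub) _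
      _ < ENNReal.ofReal (1 / ((n : ℝ) + 1)) +
            ENNReal.ofReal (L * s₁ * (Γ₂ ^ 3 * (Real.pi * 4 / 3))) :=
          ENNReal.add_lt_add_right ENNReal.ofReal_ne_top hfin
  rw [← ENNReal.ofReal_add (by positivity) (by positivity)] at hchain
  have := (ENNReal.ofReal_lt_ofReal_iff'.mp hchain).1
  linarith

/-- **No fast silencing (family level).**  `SmoothFailingFamily` re-packaged with the span floor displayed: the
`n`-th member's span satisfies `δ − 1/(n+1) < (6B²+4B³)(4π/3)Γ₂³ · s₁(n)`; in particular
`liminf_n s₁(n) ≥ δ / ((6B²+4B³)(4π/3)Γ₂³) > 0`. -/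
theorem smoothFailingFamily_span_floor (h : SmoothFailingFamily) :
    ∃ B γ δ Γ₂ : ℝ, 1 ≤ B ∧ 0 < γ ∧ 0 < δ ∧ 1 ≤ Γ₂ ∧
      ∀ n : ℕ, ∃ (ω v : ℝ → (EuclideanSpace ℝ (Fin 3)) → (EuclideanSpace ℝ (Fin 3))) (s₁ : ℝ),
        0 < s₁ ∧ s₁ ≤ 1 ∧
        DriftStretchBox B γ 1 ω v 0 (Icc 0 s₁) (2 * (Γ₂ + n)) ∧
        ENNReal.ofReal δ ≤ ∫⁻ x in ball (0 : (EuclideanSpace ℝ (Fin 3))) Γ₂, ‖ω 0 x‖ₑ ^ 2 ∧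
        ∫⁻ x in ball (0 : (EuclideanSpace ℝ (Fin 3))) (Γ₂ + n), ‖ω s₁ x‖ₑ ^ 2 <
          ENNReal.ofReal (1 / ((n : ℝ) + 1)) ∧
        δ - 1 / ((n : ℝ) + 1) < (6 * B ^ 2 + 4 * B ^ 3) * (Γ₂ ^ 3 * (Real.pi * 4 / 3)) * s₁ := by
  obtain ⟨B, γ, δ, Γ₂, hB, hγ, hδ, hΓ, hfam⟩ := h
  refine ⟨B, γ, δ, Γ₂, hB, hγ, hδ, hΓ, fun n => ?_⟩
  obtain ⟨ω, v, s₁, hs₁, hs₁1, hbox, hinit, hfin⟩ := hfam n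
  refine ⟨ω, v, s₁, hs₁, hs₁1, hbox, hinit, hfin, ?_⟩
  have := smoothFailingFamily_member_span_floor (by linarith) (by linarith) hs₁ hbox hinit hfin
  linarith

end

end Summit.NavierStokesRegularity.NavierStokesRegularity.Theorems.TypeIQuantSubcubicExp.Negative.SmoothSilence
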